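import Literature.MathematicalPhysics.QuantumFieldTheory.VillainDuality
import Literature.MathematicalPhysics.QuantumFieldTheory.VillainTranslation
import HarnessLib

/-!
# The duality transformation of the Villain `U(1)` theory on a cube for a general integer
# plaquette sheet, and the spin-wave × flux-gas form of the two-plaquette function

Fröhlich–Spencer's "transformation to the non-compact, dual model" (FS82 §2.1 (i), §2.4
(2.19)–(2.24), §2.7 (2.52)–(2.54)) is stated in §2.4 for the expectation of `e^{i⟨S, dθ⟩}` with an
ARBITRARY integer-valued plaquette function `S` (a rectangular Wilson loop is the special case
`S = 𝟙_{sheet}` by Stokes).  The tree file `VillainDuality` proves the Wilson-loop case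
(`zdVillainExpect_wilsonLoop_eq_dual`) from the general-`σ` engine
`setIntegral_tsum_angleTerm_eq`; this file records the general-sheet statement and its first
consumer, the electric two-plaquette function:

* the sheet observable `W_S(U) = Re ∏_{p ⊂ B_n} U_p^{S_p}` (`U_p` the plaquette variables of the
  cube `B_n = halfOpenBox d n`, `S : P_n → ℤ`): box-locality, gauge invariance, continuity, and its
  value `cos⟨dθ̃, S⟩` on the angle parametrisation `cfgOfAngle` (`prod_plaquette_zpow_cfgOfAngle`);
* **`zdVillainExpect_sheet_eq_dual`**: for `β > 0`,
  `⟨W_S⟩_{B_n}(β) = e^{-E_n(S)/(2β)} · (∑_ξ g(ξ) cos⟨(2πξ.out)_⊥, S⟩) / (∑_ξ g(ξ))`,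
  `ξ` over the flux classes (`VillainFibre`), `g` the Coulomb weights (`coulombWeight`),
  `E_n(S) = exactEnergy dMat S` the spin-wave energy (FS82 (2.24), (2.52)–(2.54) with a general `S`);
* the flux-gas average `A_n(S) = (∑_ξ g(ξ) cos⟨(2πξ.out)_⊥, S⟩)/(∑_ξ g(ξ))` satisfies `|A_n(S)| ≤ 1`
  (`abs_gasAverage_le_one`; positivity of the Coulomb weights);
* **the two-plaquette (electric) function**: `sin θ_p · sin θ_q = ½ W_{δ_p - δ_q} - ½ W_{δ_p + δ_q}`
  pointwise (`im_mul_im_eq_sheet`), hence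
  `⟨sin θ_p sin θ_q⟩_{B_n} = ½ e^{-E_n(δ_p-δ_q)/2β} A_n(δ_p-δ_q) - ½ e^{-E_n(δ_p+δ_q)/2β} A_n(δ_p+δ_q)`
  (`zdVillainExpect_im_mul_im_eq_dual`) with the bilinear expansion
  `E_n(δ_p ∓ δ_q) = E_n(δ_p) + E_n(δ_q) ∓ 2 B_n(p,q)` (`exactEnergy_single_sub_single`,
  `exactEnergy_single_add_single`), i.e. the SPIN-WAVE factor `e^{-(E_p+E_q)/2β} e^{±B_{pq}/β}`
  times a flux-gas (monopole) average of modulus `≤ 1` (`zdVillainExpect_im_mul_im_eq_spinWave_gas`);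
* the centred-cube form (`zdVillainExpect_box_im_mul_im`): the same function in the cube
  `box d m = {-m,…,m}^d` is the one in `B_{2m+1}` at the translated plaquettes (translation
  covariance, `VillainTranslation`).

Honest scope: exact finite-volume identities for the Villain action with free boundary conditions;
no estimate of the flux-gas averages beyond `|A| ≤ 1` (their clustering is the analytic content of
any dipole law and is NOT addressed here).  Everything is proved; no named fact is introduced.

## References

* J. Fröhlich, T. Spencer, *Massless phases and symmetry restoration in abelian gauge theories and
  spin systems*, Comm. Math. Phys. 83 (1982) 411–454, §2.1 (i), §2.4 (2.19)–(2.24) (general integer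
  2-forms), §2.7 (2.52)–(2.54), §2.11 (2.89)–(2.90) (the two-plaquette function in the dual model).
  [FrohlichSpencerCMP1982]
-/

noncomputable section

open MeasureTheory Measure Finset Function Set Matrix
open scoped Real
open Literature.Probability.LatticeModels
open Literature.Probability.LatticeModels.GaussianCoord (gram exactPart perpPart exactEnergy)
open Literature.MathematicalPhysics.QuantumLattice (u1Rep gaugeTransformZd)

namespace Literature.MathematicalPhysics.QuantumFieldTheory

namespace VillainAngle

open AxialGauge LatticeForm CircleHaar VillainFibre PeriodicUnfolding

variable {d n : ℕ} {β : ℝ}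

/-! ### Products of integer powers over a `Pi.single` exponent -/

/-- `∏_r f(r)^{(k δ_p)(r)} = f(p)^k` in a commutative group. [folklore] -/
private theorem prod_zpow_pi_single {ι G : Type*} [Fintype ι] [DecidableEq ι] [CommGroup G] (f : ι → G)
    (p : ι) (k : ℤ) : ∏ r, f r ^ (Pi.single p k : ι → ℤ) r = f p ^ k := by
  rw [Finset.prod_eq_single p (fun r _ hr => by rw [Pi.single_eq_of_ne hr, zpow_zero])
    (fun h => absurd (Finset.mem_univ p) h), Pi.single_eq_same]

/-- `∏_r f(r)^{(δ_p - δ_q)(r)} = f(p) f(q)⁻¹`. [folklore] -/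
private theorem prod_zpow_single_sub_single {ι G : Type*} [Fintype ι] [DecidableEq ι] [CommGroup G]
    (f : ι → G) (p q : ι) :
    ∏ r, f r ^ (Pi.single p (1 : ℤ) - Pi.single q 1 : ι → ℤ) r = f p * (f q)⁻¹ := by
  have h : ∀ r, f r ^ (Pi.single p (1 : ℤ) - Pi.single q 1 : ι → ℤ) r =
      f r ^ (Pi.single p (1 : ℤ) : ι → ℤ) r * (f r ^ (Pi.single q (1 : ℤ) : ι → ℤ) r)⁻¹ := by
    intro r
    rw [Pi.sub_apply, _root_.zpow_sub]
  simp_rw [h]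
  rw [Finset.prod_mul_distrib, Finset.prod_inv_distrib, prod_zpow_pi_single, prod_zpow_pi_single,
    zpow_one, zpow_one]

/-- `∏_r f(r)^{(δ_p + δ_q)(r)} = f(p) f(q)`. [folklore] -/
private theorem prod_zpow_single_add_single {ι G : Type*} [Fintype ι] [DecidableEq ι] [CommGroup G]
    (f : ι → G) (p q : ι) :
    ∏ r, f r ^ (Pi.single p (1 : ℤ) + Pi.single q 1 : ι → ℤ) r = f p * f q := by
  have h : ∀ r, f r ^ (Pi.single p (1 : ℤ) + Pi.single q 1 : ι → ℤ) r =
      f r ^ (Pi.single p (1 : ℤ) : ι → ℤ) r * f r ^ (Pi.single q (1 : ℤ) : ι → ℤ) r := by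
    intro r
    rw [Pi.add_apply, _root_.zpow_add]
  simp_rw [h]
  rw [Finset.prod_mul_distrib, prod_zpow_pi_single, prod_zpow_pi_single, zpow_one, zpow_one]

/-! ### The sheet observable `W_S(U) = Re ∏_p U_p^{S_p}` -/

/-- The sheet holonomy `∏_{p ⊂ B_n} U_p^{S_p}` only reads the edges of `B_n`. [folklore] -/
private theorem prod_plaquette_zpow_ext_restrict (S : PIdx d n → ℤ) (U : ZdGaugeConfig d Circle) :
    (∏ p : PIdx d n, (ext ((boxEdges d n).restrict U)).plaquette p.1.1 p.1.2.1 p.1.2.2 ^ S p) =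
      ∏ p : PIdx d n, U.plaquette p.1.1 p.1.2.1 p.1.2.2 ^ S p := by
  refine Finset.prod_congr rfl fun p _ => ?_
  obtain ⟨h1, h2, h3, h4⟩ := edges_mem_boxEdges p.2
  rw [plaquette_congr (ext_restrict_apply U h1) (ext_restrict_apply U h2) (ext_restrict_apply U h3)
    (ext_restrict_apply U h4)]

/-- The sheet holonomy is gauge invariant (`U(1)` is abelian). [cite: FrohlichSpencerCMP1982, §2.2] -/
theorem prod_plaquette_zpow_gaugeTransformZd (S : PIdx d n → ℤ)
    (g : Literature.Probability.LatticeModels.Site d → Circle) (U : ZdGaugeConfig d Circle) :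
    (∏ p : PIdx d n, ZdGaugeConfig.plaquette (gaugeTransformZd g U) p.1.1 p.1.2.1 p.1.2.2 ^ S p) =
      ∏ p : PIdx d n, U.plaquette p.1.1 p.1.2.1 p.1.2.2 ^ S p := by
  simp_rw [plaquette_gaugeTransformZd_comm]

/-- The sheet observable `W_S = Re ∏_p U_p^{S_p}` is box-local. [folklore] -/
private theorem sheet_ext_restrict (S : PIdx d n → ℤ) (U : ZdGaugeConfig d Circle) :
    (((∏ p : PIdx d n, (ext ((boxEdges d n).restrict U)).plaquette p.1.1 p.1.2.1 p.1.2.2 ^ S p :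
        Circle) : ℂ).re) =
      ((∏ p : PIdx d n, U.plaquette p.1.1 p.1.2.1 p.1.2.2 ^ S p : Circle) : ℂ).re := by
  rw [prod_plaquette_zpow_ext_restrict]

/-- The sheet observable is invariant under the axial gauge fixing of box configurations.
[folklore] -/
private theorem sheet_ext_gaugeFixBox (S : PIdx d n → ℤ) (u : BoxCfg d Circle n) :
    (((∏ p : PIdx d n, (ext (gaugeFixBox u)).plaquette p.1.1 p.1.2.1 p.1.2.2 ^ S p : Circle) : ℂ).re) =
      ((∏ p : PIdx d n, (ext u).plaquette p.1.1 p.1.2.1 p.1.2.2 ^ S p : Circle) : ℂ).re := by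
  rw [gaugeFixBox, prod_plaquette_zpow_ext_restrict, gaugeFix, prod_plaquette_zpow_gaugeTransformZd]

/-- The sheet holonomy is continuous in the configuration. [folklore] -/
private theorem continuous_prod_plaquette_zpow (S : PIdx d n → ℤ) :
    Continuous fun U : ZdGaugeConfig d Circle =>
      ∏ p : PIdx d n, U.plaquette p.1.1 p.1.2.1 p.1.2.2 ^ S p :=
  continuous_finsetProd _ fun p _ => (AreaLaw.continuous_plaquette _ _ _).zpow (S p)

/-- The sheet observable `W_S = Re e^{i⟨S,dθ⟩}` is continuous (hence measurable) in the
configuration. [cite: FrohlichSpencerCMP1982, §2.4 (2.19)–(2.20)] -/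
theorem continuous_sheet (S : PIdx d n → ℤ) :
    Continuous fun U : ZdGaugeConfig d Circle =>
      ((∏ p : PIdx d n, U.plaquette p.1.1 p.1.2.1 p.1.2.2 ^ S p : Circle) : ℂ).re :=
  Complex.continuous_re.comp (continuous_subtype_val.comp (continuous_prod_plaquette_zpow S))

/-- **The sheet holonomy in angles**: for `U = cfgOfAngle θ`, `∏_p U_p^{S_p} = e^{i⟨dθ̃, S⟩}`.
[cite: FrohlichSpencerCMP1982, §2.4 (2.19)] -/
theorem prod_plaquette_zpow_cfgOfAngle (S : PIdx d n → ℤ) (θ : AngleCfg d n) :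
    (∏ p : PIdx d n, (cfgOfAngle θ).plaquette p.1.1 p.1.2.1 p.1.2.2 ^ S p) =
      Circle.exp (dFreeR θ ⬝ᵥ fun p => (S p : ℝ)) := by
  simp_rw [plaquette_cfgOfAngle, ← Circle.exp_intCast_mul]
  rw [dotProduct, circleExp_sum]
  refine Finset.prod_congr rfl fun p _ => ?_
  rw [dFreeR_apply, mul_comm]

/-- **The sheet observable in angles**: `W_S(cfgOfAngle θ) = cos⟨dθ̃, S⟩`.
[cite: FrohlichSpencerCMP1982, §2.4 (2.19)–(2.20)] -/
theorem sheet_cfgOfAngle (S : PIdx d n → ℤ) (θ : AngleCfg d n) :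
    (((∏ p : PIdx d n, (cfgOfAngle θ).plaquette p.1.1 p.1.2.1 p.1.2.2 ^ S p : Circle) : ℂ).re) =
      Real.cos (dFreeR θ ⬝ᵥ fun p => (S p : ℝ)) := by
  rw [prod_plaquette_zpow_cfgOfAngle, Circle.coe_exp, Complex.exp_ofReal_mul_I_re]

/-! ### The duality formula for a general sheet -/

/-- **The duality transformation of the Villain theory on a cube for a general integer sheet**
(Fröhlich–Spencer's transformation to the non-compact dual model, primal flux language): for
`β > 0` and any integer plaquette function `S` on `B_n`,

`⟨Re ∏_p U_p^{S_p}⟩_{B_n}(β) = e^{-E_n(S)/(2β)} · (∑_ξ g(ξ) cos⟨(2πξ.out)_⊥, S⟩) / (∑_ξ g(ξ))`,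

`ξ` over the flux classes of integer plaquette fields of `B_n`, `g` the Coulomb weights
(`coulombWeight`), `E_n(S) = exactEnergy dMat S` the spin-wave energy and `(·)_⊥ = perpPart dMat`.
The Wilson loop (`zdVillainExpect_wilsonLoop_eq_dual`) is the case `S = 𝟙_{sheet}`.
[cite: FrohlichSpencerCMP1982, §2.4 (2.19)–(2.24) and §2.7 (2.52)–(2.54)] -/
theorem zdVillainExpect_sheet_eq_dual (hβ : 0 < β) (S : PIdx d n → ℤ) :
    zdVillainExpect β (halfOpenBox d n)
        (fun U => ((∏ p : PIdx d n, U.plaquette p.1.1 p.1.2.1 p.1.2.2 ^ S p : Circle) : ℂ).re) =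
      Real.exp (-(exactEnergy dMat (fun p => (S p : ℝ))) / (2 * β)) *
        (∑' ξ : (PIdx d n → ℤ) ⧸ (dFree (d := d) (n := n)).range,
            coulombWeight β ξ * Real.cos (perpPart dMat (fluxRep ξ) ⬝ᵥ fun p => (S p : ℝ))) /
          ∑' ξ : (PIdx d n → ℤ) ⧸ (dFree (d := d) (n := n)).range, coulombWeight β ξ := by
  set σ : PIdx d n → ℝ := fun p => (S p : ℝ) with hσ
  rw [zdVillainExpect_eq_angle_ratio hβ _ (continuous_sheet S).measurable
    (fun U => (sheet_ext_restrict S U).symm) (sheet_ext_gaugeFixBox S)]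
  -- the integrands as series of the terms
  have hnum : ∀ θ : FIdx d n → ℝ,
      (∏ p ∈ plaquettesIn (halfOpenBox d n), villainKernel β (d₁ (extAngle θ) p.1 p.2.1 p.2.2)) *
          (((∏ p : PIdx d n, (cfgOfAngle θ).plaquette p.1.1 p.1.2.1 p.1.2.2 ^ S p : Circle) : ℂ).re) =
        ∑' m : PIdx d n → ℤ, angleTerm β σ m θ := by
    intro θ
    rw [sheet_cfgOfAngle, ← Finset.prod_coe_sort]
    exact prod_villainKernel_mul_cos_eq_tsum_angleTerm hβ _ θ
  have hden : ∀ θ : FIdx d n → ℝ,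
      (∏ p ∈ plaquettesIn (halfOpenBox d n), villainKernel β (d₁ (extAngle θ) p.1 p.2.1 p.2.2)) =
        ∑' m : PIdx d n → ℤ, angleTerm β (0 : PIdx d n → ℝ) m θ := by
    intro θ
    have h := prod_villainKernel_mul_cos_eq_tsum_angleTerm hβ (0 : PIdx d n → ℤ) θ
    have h0 : (fun p : PIdx d n => (((0 : PIdx d n → ℤ) p : ℤ) : ℝ)) = 0 := by
      funext p; simp
    rw [h0, dotProduct_zero, Real.cos_zero, mul_one] at h
    simp only [dFreeR_apply] at h
    rw [Finset.prod_coe_sort (plaquettesIn (halfOpenBox d n))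
      (fun p : Plaq d => villainKernel β (d₁ (extAngle θ) p.1 p.2.1 p.2.2))] at h
    rw [h]
  simp_rw [hnum, hden]
  rw [setIntegral_pi_Ioc_eq_pi_Ico, setIntegral_pi_Ioc_eq_pi_Ico]
  change (∫ θ in angleBox d n, _) / (∫ θ in angleBox d n, _) = _
  rw [(setIntegral_tsum_angleTerm_eq hβ σ).2, (setIntegral_tsum_angleTerm_eq hβ 0).2]
  have hE0 : exactEnergy (dMat (d := d) (n := n)) 0 = 0 := by simp [exactEnergy]
  simp only [hE0, neg_zero, zero_div, Real.exp_zero, one_mul, dotProduct_zero, Real.cos_zero, mul_one]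

/-! ### The flux-gas average -/

/-- The Coulomb (monopole-gas) weights `g(ξ)` of the dual model are summable over the flux
classes (`β > 0`): the dual partition function `∑_ξ g(ξ)` of FS82 (2.24) converges.
[cite: FrohlichSpencerCMP1982, §2.4 (2.24)] -/
theorem summable_coulombWeight (hβ : 0 < β) :
    Summable fun ξ : (PIdx d n → ℤ) ⧸ (dFree (d := d) (n := n)).range => coulombWeight β ξ := by
  have h := (setIntegral_tsum_angleTerm_eq (d := d) (n := n) hβ 0).1
  simpa only [dotProduct_zero, Real.cos_zero, mul_one] using h

/-- The dual (flux-gas) partition function `∑_ξ g(ξ)` of FS82 (2.24) is positive (`β > 0`).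
[cite: FrohlichSpencerCMP1982, §2.4 (2.24)] -/
theorem tsum_coulombWeight_pos (hβ : 0 < β) :
    0 < ∑' ξ : (PIdx d n → ℤ) ⧸ (dFree (d := d) (n := n)).range, coulombWeight β ξ :=
  (summable_coulombWeight hβ).tsum_pos (fun ξ => (coulombWeight_pos hβ ξ).le) (0 : _)
    (coulombWeight_pos hβ _)

/-- `|∑_ξ g(ξ) cos⟨ξ_⊥, σ⟩| ≤ ∑_ξ g(ξ)`. [folklore] -/
private theorem abs_tsum_coulombWeight_mul_cos_le (hβ : 0 < β) (σ : PIdx d n → ℝ) :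
    |∑' ξ : (PIdx d n → ℤ) ⧸ (dFree (d := d) (n := n)).range,
        coulombWeight β ξ * Real.cos (perpPart dMat (fluxRep ξ) ⬝ᵥ σ)| ≤
      ∑' ξ : (PIdx d n → ℤ) ⧸ (dFree (d := d) (n := n)).range, coulombWeight β ξ := by
  have hs := (setIntegral_tsum_angleTerm_eq (d := d) (n := n) hβ σ).1
  have h1 := norm_tsum_le_tsum_norm hs.norm
  rw [Real.norm_eq_abs] at h1
  refine h1.trans (hs.norm.tsum_le_tsum (fun ξ => ?_) (summable_coulombWeight hβ))
  rw [Real.norm_eq_abs, abs_mul, abs_of_pos (coulombWeight_pos hβ ξ)]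
  exact mul_le_of_le_one_right (coulombWeight_pos hβ ξ).le (Real.abs_cos_le_one _)

/-- **The flux-gas average has modulus at most one**:
`|(∑_ξ g(ξ) cos⟨ξ_⊥, σ⟩) / (∑_ξ g(ξ))| ≤ 1` (`β > 0`; the Coulomb weights of FS82 (2.24) are
positive and `|cos| ≤ 1`). [cite: FrohlichSpencerCMP1982, §2.4 (2.24)] -/
theorem abs_gasAverage_le_one (hβ : 0 < β) (σ : PIdx d n → ℝ) :
    |(∑' ξ : (PIdx d n → ℤ) ⧸ (dFree (d := d) (n := n)).range,
          coulombWeight β ξ * Real.cos (perpPart dMat (fluxRep ξ) ⬝ᵥ σ)) /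
        ∑' ξ : (PIdx d n → ℤ) ⧸ (dFree (d := d) (n := n)).range, coulombWeight β ξ| ≤ 1 := by
  have hZ := tsum_coulombWeight_pos (d := d) (n := n) hβ
  rw [abs_div, abs_of_pos hZ, div_le_one hZ]
  exact abs_tsum_coulombWeight_mul_cos_le hβ σ

/-! ### The two-plaquette (electric) function -/

/-- `Im z · Im w = ½ Re(z w⁻¹) - ½ Re(z w)` on the unit circle. [folklore] -/
private theorem im_mul_im_eq_re (z w : Circle) :
    (z : ℂ).im * (w : ℂ).im =
      1 / 2 * ((z * w⁻¹ : Circle) : ℂ).re - 1 / 2 * ((z * w : Circle) : ℂ).re := by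
  rw [Circle.coe_mul, Circle.coe_mul, Circle.coe_inv_eq_conj, Complex.mul_re, Complex.mul_re,
    Complex.conj_re, Complex.conj_im]
  ring

/-- **`sin θ_p sin θ_q` as sheet observables**: pointwise in the configuration,
`Im U_p · Im U_q = ½ Re ∏_r U_r^{(δ_p - δ_q)(r)} - ½ Re ∏_r U_r^{(δ_p + δ_q)(r)}`.
[cite: FrohlichSpencerCMP1982, §2.11 (2.89)–(2.90)] -/
theorem im_mul_im_eq_sheet (p q : PIdx d n) (U : ZdGaugeConfig d Circle) :
    ((U.plaquette p.1.1 p.1.2.1 p.1.2.2 : Circle) : ℂ).im *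
        ((U.plaquette q.1.1 q.1.2.1 q.1.2.2 : Circle) : ℂ).im =
      1 / 2 * ((∏ r : PIdx d n, U.plaquette r.1.1 r.1.2.1 r.1.2.2 ^
          (Pi.single p (1 : ℤ) - Pi.single q 1 : PIdx d n → ℤ) r : Circle) : ℂ).re -
        1 / 2 * ((∏ r : PIdx d n, U.plaquette r.1.1 r.1.2.1 r.1.2.2 ^
          (Pi.single p (1 : ℤ) + Pi.single q 1 : PIdx d n → ℤ) r : Circle) : ℂ).re := by
  rw [prod_zpow_single_sub_single (fun r : PIdx d n => U.plaquette r.1.1 r.1.2.1 r.1.2.2),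
    prod_zpow_single_add_single (fun r : PIdx d n => U.plaquette r.1.1 r.1.2.1 r.1.2.2)]
  exact im_mul_im_eq_re _ _

/-- A sheet observable `W_S` is integrable for the Villain measure (2.3) of the cube (`β > 0`: a
probability measure; the observable is continuous and bounded by `1`).
[cite: FrohlichSpencerCMP1982, §2.2 (2.3), §2.4 (2.19)] -/
theorem integrable_sheet (hβ : 0 < β) (S : PIdx d n → ℤ) :
    Integrable (fun U : ZdGaugeConfig d Circle =>
        ((∏ p : PIdx d n, U.plaquette p.1.1 p.1.2.1 p.1.2.2 ^ S p : Circle) : ℂ).re)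
      (zdVillainMeasure β (halfOpenBox d n)) := by
  haveI := isProbabilityMeasure_zdVillainMeasure (d := d) hβ (halfOpenBox d n)
  refine Integrable.of_bound (continuous_sheet S).measurable.aestronglyMeasurable 1
    (Filter.Eventually.of_forall fun U => ?_)
  rw [Real.norm_eq_abs]
  exact (Complex.abs_re_le_norm _).trans_eq (Circle.norm_coe _)

/-- **The Villain two-plaquette function in the dual model**: for `β > 0` and plaquettes `p, q` of
`B_n`,
`⟨Im U_p · Im U_q⟩_{B_n}(β) = ½ e^{-E_n(δ_p-δ_q)/2β} A_n(δ_p-δ_q) - ½ e^{-E_n(δ_p+δ_q)/2β} A_n(δ_p+δ_q)`,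
`A_n(S) = (∑_ξ g(ξ) cos⟨(2πξ.out)_⊥, S⟩)/(∑_ξ g(ξ))` the flux-gas average.
[cite: FrohlichSpencerCMP1982, §2.4 (2.24), §2.11 (2.89)–(2.90)] -/
theorem zdVillainExpect_im_mul_im_eq_dual (hβ : 0 < β) (p q : PIdx d n) :
    zdVillainExpect β (halfOpenBox d n) (fun U =>
        ((U.plaquette p.1.1 p.1.2.1 p.1.2.2 : Circle) : ℂ).im *
          ((U.plaquette q.1.1 q.1.2.1 q.1.2.2 : Circle) : ℂ).im) =
      1 / 2 * (Real.exp (-(exactEnergy dMat (fun r => ((Pi.single p (1 : ℤ) - Pi.single q 1 :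
            PIdx d n → ℤ) r : ℝ))) / (2 * β)) *
          (∑' ξ : (PIdx d n → ℤ) ⧸ (dFree (d := d) (n := n)).range,
              coulombWeight β ξ * Real.cos (perpPart dMat (fluxRep ξ) ⬝ᵥ fun r =>
                ((Pi.single p (1 : ℤ) - Pi.single q 1 : PIdx d n → ℤ) r : ℝ))) /
            ∑' ξ : (PIdx d n → ℤ) ⧸ (dFree (d := d) (n := n)).range, coulombWeight β ξ) -
        1 / 2 * (Real.exp (-(exactEnergy dMat (fun r => ((Pi.single p (1 : ℤ) + Pi.single q 1 :
            PIdx d n → ℤ) r : ℝ))) / (2 * β)) *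
          (∑' ξ : (PIdx d n → ℤ) ⧸ (dFree (d := d) (n := n)).range,
              coulombWeight β ξ * Real.cos (perpPart dMat (fluxRep ξ) ⬝ᵥ fun r =>
                ((Pi.single p (1 : ℤ) + Pi.single q 1 : PIdx d n → ℤ) r : ℝ))) /
            ∑' ξ : (PIdx d n → ℤ) ⧸ (dFree (d := d) (n := n)).range, coulombWeight β ξ) := by
  rw [← zdVillainExpect_sheet_eq_dual hβ, ← zdVillainExpect_sheet_eq_dual hβ, zdVillainExpect_def,
    zdVillainExpect_def, zdVillainExpect_def, ← integral_const_mul, ← integral_const_mul,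
    ← integral_sub ((integrable_sheet hβ _).const_mul _) ((integrable_sheet hβ _).const_mul _)]
  exact integral_congr_ae (Filter.Eventually.of_forall fun U => im_mul_im_eq_sheet p q U)

/-! ### The spin-wave energies of `δ_p ∓ δ_q` -/

/-- The spin-wave bilinear form is symmetric: `(Tᵀa)·(M⁻¹ Tᵀ b) = (Tᵀb)·(M⁻¹ Tᵀ a)`
(`M = TᵀT` is symmetric, hence so is `M⁻¹`). [folklore] -/
private theorem exactEnergy_bilin_comm {κ ι : Type*} [Fintype κ] [Fintype ι] [DecidableEq ι]
    (T : Matrix κ ι ℝ) (a b : κ → ℝ) :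
    (Tᵀ *ᵥ a) ⬝ᵥ ((Literature.Probability.LatticeModels.GaussianCoord.gram T)⁻¹ *ᵥ (Tᵀ *ᵥ b)) =
      (Tᵀ *ᵥ b) ⬝ᵥ ((Literature.Probability.LatticeModels.GaussianCoord.gram T)⁻¹ *ᵥ (Tᵀ *ᵥ a)) := by
  have hsymm : ((Literature.Probability.LatticeModels.GaussianCoord.gram T)⁻¹)ᵀ = (Literature.Probability.LatticeModels.GaussianCoord.gram T)⁻¹ := by
    rw [Matrix.transpose_nonsing_inv, Literature.Probability.LatticeModels.GaussianCoord.gram, Matrix.transpose_mul,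
      Matrix.transpose_transpose]
  rw [Matrix.dotProduct_mulVec, ← Matrix.mulVec_transpose, hsymm, dotProduct_comm]

/-- **Bilinear expansion, difference**: `E_T(a - b) = E_T(a) + E_T(b) - 2 B_T(a, b)` with
`B_T(a,b) = (Tᵀa)·(M⁻¹Tᵀb)`. [folklore] -/
private theorem exactEnergy_sub {κ ι : Type*} [Fintype κ] [Fintype ι] [DecidableEq ι]
    (T : Matrix κ ι ℝ) (a b : κ → ℝ) :
    exactEnergy T (a - b) =
      exactEnergy T a + exactEnergy T b - 2 * ((Tᵀ *ᵥ a) ⬝ᵥ ((Literature.Probability.LatticeModels.GaussianCoord.gram T)⁻¹ *ᵥ (Tᵀ *ᵥ b))) := by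
  have hc := exactEnergy_bilin_comm T a b
  simp only [exactEnergy, Matrix.mulVec_sub, sub_dotProduct, dotProduct_sub]
  linarith

/-- **Bilinear expansion, sum**: `E_T(a + b) = E_T(a) + E_T(b) + 2 B_T(a, b)`. [folklore] -/
private theorem exactEnergy_add {κ ι : Type*} [Fintype κ] [Fintype ι] [DecidableEq ι]
    (T : Matrix κ ι ℝ) (a b : κ → ℝ) :
    exactEnergy T (a + b) =
      exactEnergy T a + exactEnergy T b + 2 * ((Tᵀ *ᵥ a) ⬝ᵥ ((Literature.Probability.LatticeModels.GaussianCoord.gram T)⁻¹ *ᵥ (Tᵀ *ᵥ b))) := by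
  have hc := exactEnergy_bilin_comm T a b
  simp only [exactEnergy, Matrix.mulVec_add, add_dotProduct, dotProduct_add]
  linarith

/-- The real sheet of `δ_p - δ_q` is the difference of the real indicator sheets. [folklore] -/
private theorem intCast_single_sub_single (p q : PIdx d n) :
    (fun r => ((Pi.single p (1 : ℤ) - Pi.single q 1 : PIdx d n → ℤ) r : ℝ)) =
      (Pi.single p (1 : ℝ) : PIdx d n → ℝ) - Pi.single q 1 := by
  funext r
  simp only [Pi.sub_apply, Int.cast_sub]
  by_cases hp : r = p <;> by_cases hq : r = q <;> subst_vars <;> simp_all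

/-- The real sheet of `δ_p + δ_q` is the sum of the real indicator sheets. [folklore] -/
private theorem intCast_single_add_single (p q : PIdx d n) :
    (fun r => ((Pi.single p (1 : ℤ) + Pi.single q 1 : PIdx d n → ℤ) r : ℝ)) =
      (Pi.single p (1 : ℝ) : PIdx d n → ℝ) + Pi.single q 1 := by
  funext r
  simp only [Pi.add_apply, Int.cast_add]
  by_cases hp : r = p <;> by_cases hq : r = q <;> subst_vars <;> simp_all

/-- **Spin-wave energy of `δ_p - δ_q`**: `E_n(δ_p - δ_q) = E_n(δ_p) + E_n(δ_q) - 2 B_n(p, q)`.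
[cite: FrohlichSpencerCMP1982, §2.11 (2.90)] -/
theorem exactEnergy_single_sub_single (p q : PIdx d n) :
    exactEnergy dMat (fun r => ((Pi.single p (1 : ℤ) - Pi.single q 1 : PIdx d n → ℤ) r : ℝ)) =
      exactEnergy dMat (Pi.single p (1 : ℝ)) + exactEnergy dMat (Pi.single q (1 : ℝ)) -
        2 * ((dMatᵀ *ᵥ (Pi.single p (1 : ℝ) : PIdx d n → ℝ)) ⬝ᵥ
          ((gram (dMat (d := d) (n := n)))⁻¹ *ᵥ (dMatᵀ *ᵥ (Pi.single q (1 : ℝ) : PIdx d n → ℝ)))) := by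
  rw [intCast_single_sub_single, exactEnergy_sub]

/-- **Spin-wave energy of `δ_p + δ_q`**: `E_n(δ_p + δ_q) = E_n(δ_p) + E_n(δ_q) + 2 B_n(p, q)`.
[cite: FrohlichSpencerCMP1982, §2.11 (2.90)] -/
theorem exactEnergy_single_add_single (p q : PIdx d n) :
    exactEnergy dMat (fun r => ((Pi.single p (1 : ℤ) + Pi.single q 1 : PIdx d n → ℤ) r : ℝ)) =
      exactEnergy dMat (Pi.single p (1 : ℝ)) + exactEnergy dMat (Pi.single q (1 : ℝ)) +
        2 * ((dMatᵀ *ᵥ (Pi.single p (1 : ℝ) : PIdx d n → ℝ)) ⬝ᵥ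
          ((gram (dMat (d := d) (n := n)))⁻¹ *ᵥ (dMatᵀ *ᵥ (Pi.single q (1 : ℝ) : PIdx d n → ℝ)))) := by
  rw [intCast_single_add_single, exactEnergy_add]

/-- **Spin-wave × flux-gas form of the two-plaquette function.**  For `β > 0` and plaquettes
`p, q` of `B_n`, with `E_p = E_n(δ_p)`, `E_q = E_n(δ_q)`, `B = B_n(p,q)` and the flux-gas averages
`A^∓ = A_n(δ_p ∓ δ_q)` (each of modulus `≤ 1`, `abs_gasAverage_le_one`):
`⟨Im U_p · Im U_q⟩_{B_n}(β) = ½ e^{-(E_p+E_q)/(2β)} (e^{B/β} A⁻ - e^{-B/β} A⁺)`.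
For the pure spin wave (`A^∓ = 1`) this is `e^{-(E_p+E_q)/2β} sinh(B/β)`, the Gaussian dipole
law; the monopole (flux-gas) corrections enter only through `A^∓`.
[cite: FrohlichSpencerCMP1982, §2.11 (2.89)–(2.90)] -/
theorem zdVillainExpect_im_mul_im_eq_spinWave_gas (hβ : 0 < β) (p q : PIdx d n) :
    zdVillainExpect β (halfOpenBox d n) (fun U =>
        ((U.plaquette p.1.1 p.1.2.1 p.1.2.2 : Circle) : ℂ).im *
          ((U.plaquette q.1.1 q.1.2.1 q.1.2.2 : Circle) : ℂ).im) =
      1 / 2 * Real.exp (-(exactEnergy dMat (Pi.single p (1 : ℝ)) +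
          exactEnergy dMat (Pi.single q (1 : ℝ))) / (2 * β)) *
        (Real.exp (((dMatᵀ *ᵥ (Pi.single p (1 : ℝ) : PIdx d n → ℝ)) ⬝ᵥ
              ((gram (dMat (d := d) (n := n)))⁻¹ *ᵥ (dMatᵀ *ᵥ (Pi.single q (1 : ℝ) : PIdx d n → ℝ)))) / β) *
            ((∑' ξ : (PIdx d n → ℤ) ⧸ (dFree (d := d) (n := n)).range,
                coulombWeight β ξ * Real.cos (perpPart dMat (fluxRep ξ) ⬝ᵥ fun r =>
                  ((Pi.single p (1 : ℤ) - Pi.single q 1 : PIdx d n → ℤ) r : ℝ))) /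
              ∑' ξ : (PIdx d n → ℤ) ⧸ (dFree (d := d) (n := n)).range, coulombWeight β ξ) -
          Real.exp (-((dMatᵀ *ᵥ (Pi.single p (1 : ℝ) : PIdx d n → ℝ)) ⬝ᵥ
              ((gram (dMat (d := d) (n := n)))⁻¹ *ᵥ (dMatᵀ *ᵥ (Pi.single q (1 : ℝ) : PIdx d n → ℝ)))) / β) *
            ((∑' ξ : (PIdx d n → ℤ) ⧸ (dFree (d := d) (n := n)).range,
                coulombWeight β ξ * Real.cos (perpPart dMat (fluxRep ξ) ⬝ᵥ fun r =>
                  ((Pi.single p (1 : ℤ) + Pi.single q 1 : PIdx d n → ℤ) r : ℝ))) /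
              ∑' ξ : (PIdx d n → ℤ) ⧸ (dFree (d := d) (n := n)).range, coulombWeight β ξ)) := by
  rw [zdVillainExpect_im_mul_im_eq_dual hβ, exactEnergy_single_sub_single, exactEnergy_single_add_single]
  have hβ0 : β ≠ 0 := hβ.ne'
  set Ep := exactEnergy dMat (Pi.single p (1 : ℝ) : PIdx d n → ℝ)
  set Eq' := exactEnergy dMat (Pi.single q (1 : ℝ) : PIdx d n → ℝ)
  set B := (dMatᵀ *ᵥ (Pi.single p (1 : ℝ) : PIdx d n → ℝ)) ⬝ᵥ
    ((gram (dMat (d := d) (n := n)))⁻¹ *ᵥ (dMatᵀ *ᵥ (Pi.single q (1 : ℝ) : PIdx d n → ℝ)))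
  have h1 : Real.exp (-(Ep + Eq' - 2 * B) / (2 * β)) = Real.exp (-(Ep + Eq') / (2 * β)) * Real.exp (B / β) := by
    rw [← Real.exp_add]; congr 1; field_simp; ring
  have h2 : Real.exp (-(Ep + Eq' + 2 * B) / (2 * β)) = Real.exp (-(Ep + Eq') / (2 * β)) * Real.exp (-B / β) := by
    rw [← Real.exp_add]; congr 1; field_simp; ring
  rw [h1, h2]
  ring

/-! ### Centred cubes -/

/-- **Centred cubes versus axial-gauge cubes for the two-plaquette function**: for `β > 0`,
`⟨Im U_{(x+m𝟙;i,j)} Im U_{(y+m𝟙;k,l)}⟩_{halfOpenBox d (2m+1)} = ⟨Im U_{(x;i,j)} Im U_{(y;k,l)}⟩_{box d m}`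
(translation covariance of the free-boundary Villain expectation).
[cite: FrohlichSpencerCMP1982, §2.2 (footnote 2)] -/
theorem zdVillainExpect_box_im_mul_im (hβ : 0 < β) (m : ℕ)
    (x y : Literature.Probability.LatticeModels.Site d) (i j k l : Fin d) :
    zdVillainExpect β (halfOpenBox d (2 * m + 1)) (fun U =>
        ((U.plaquette (x + diag d m) i j : Circle) : ℂ).im * ((U.plaquette (y + diag d m) k l : Circle) : ℂ).im) =
      zdVillainExpect β (box d m) (fun U =>
        ((U.plaquette x i j : Circle) : ℂ).im * ((U.plaquette y k l : Circle) : ℂ).im) := by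
  have hc : Continuous fun U : ZdGaugeConfig d Circle =>
      ((U.plaquette (x + diag d m) i j : Circle) : ℂ).im * ((U.plaquette (y + diag d m) k l : Circle) : ℂ).im :=
    (Complex.continuous_im.comp (continuous_subtype_val.comp
      (AreaLaw.continuous_plaquette (G := Circle) (x + diag d m) i j))).mul
      (Complex.continuous_im.comp (continuous_subtype_val.comp
        (AreaLaw.continuous_plaquette (G := Circle) (y + diag d m) k l)))
  have hm : Measurable fun U : ZdGaugeConfig d Circle =>
      ((U.plaquette (x + diag d m) i j : Circle) : ℂ).im * ((U.plaquette (y + diag d m) k l : Circle) : ℂ).im :=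
    hc.measurable
  rw [← image_add_diag_box, zdVillainExpect_image_add hβ _ _ _ hm]
  congr 1
  funext U
  simp only [Function.comp_apply, plaquette_translate, add_neg_cancel_right]

end VillainAngle

end Literature.MathematicalPhysics.QuantumFieldTheory
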